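import Summits.ResolutionOfSingularities.ResolutionOfSingularities.Theorems.FrobeniusClosingPatchingRelPerfectDepthPhaseCCarrierGameLiftPushforward
import HarnessLib

/-!
# Crux `PatchingRelPerfect` (stmt-ResolutionOfSingularities-16161), chain W5.2 — F7(β) (β-AX) X3 C-I (M2b-T), (T-a′): THE VEHICLE —
# plain push-forward of a regular centre sequence from a carrier (`…DepthPhaseCContactPushforward`)

[OURS · L1 W5.2 · F7(β) (β-AX) X3 C-I (M2b-T) · res-L1-w52-plan-1 RULING G12-32 (ii) / tri-2 (d), hand res-D-repro-1 AS res-L1-repro-3]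
The MULTIPLICITY-FREE twin of res-D-pv-046΄s `CarrierGoingUp.centreSeq_goingUp` (p560603): NO marked ideal, NO admissibility, NO
`ker ≤ (M)_r` — along a closed immersion `j : S ↪ X` onto a REGULAR HYPERSURFACE of a regular locally Noetherian `X` (order-one stalk
generators of `ker j`), EVERY centre sequence `t` on `S` with REGULAR centres pushes forward (Kollár 3.30.3, tree `CentreSeq.pushforward`) to
a centre sequence `j_* t` on `X` with regular centres and REGULAR TOP, whose last embedding `j_r : S_r ↪ X_r` (`CentreSeq.pushforwardι`, a
closed immersion) is again a regular hypersurface (order-one generators of `ker j_r`: `S_r` is the strict transform of `S`), together with: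
the TOTAL-TRANSFORM RULE `(K𝒪_{X_r})|_{S_r} = (K|_S)𝒪_{S_r}` (`comap_pushforward_comp`, from `CentreSeq.pushforward_comp_ι`), and LEGALITY
transport `t.CentresOver (j⁻¹ T) ⇒ (j_* t).CentresOver T` (`centresOver_pushforward`) — in particular centres over `cosupp (K|_S)` push to
centres over `cosupp K`.  This is the vehicle of the (M2b-T) CONTACT TRANSPORT (F-60΄s sequence on the contact surface inside the carrier ↦
a PhaseCOne-legal sequence on `X`).  Def-free; NOT a statement of the manuscript under review; AI-written, weaker than expert review.
Mathlib + landed W5.2 / Literature files only (`blowup.ker_pushforwardMap`, `IsBlowup.exists_generator_notMem_sq_controlledTransform`,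
`IsBlowup.isRegular_of_isRegular_subscheme`, `isRegular_subscheme_map_iff_of_isClosedImmersion`, `coe_support_map_of_isClosedImmersion`);
no fact, no sorry.

## References
* J. Kollár, *Lectures on Resolution of Singularities* (2007), 3.30.2–3.30.3 (push-forward of blow-up sequences), Cor. 3.85. [Kollar2007]
* E. Bierstone, D. Grigoriev, P. Milman, J. Włodarczyk, *Effective Hironaka resolution …* (2011), Lemma 3.9.4 (2)–(3). [BierstoneGrigorievMilmanWlodarczyk2011]
-/

-- `Summit.<Summit>.<Sub>.Theorems` with `Sub = Summit` (single-conjunct summit, D-0017)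
set_option linter.dupNamespace false

noncomputable section

open CategoryTheory AlgebraicGeometry TopologicalSpace IsLocalRing
open Literature.AlgebraicGeometry.Resolution

namespace Summit.ResolutionOfSingularities.ResolutionOfSingularities.Theorems

namespace ContactPushforward

universe u

variable {S X : Scheme.{u}}

/-! ## §1 Regular centres push forward to regular centres with regular top, the carrier staying a regular hypersurface -/

/-- [OURS · L1 W5.2 · (M2b-T) (T-a′)] **THE VEHICLE**: along a closed immersion onto a regular hypersurface of a regular locally Noetherian
scheme, a centre sequence with REGULAR centres pushes forward to one with regular centres, REGULAR TOP, and last embedding again a regular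
hypersurface (order-one stalk generators of its kernel). [cite: Kollar2007, 3.30.3, Cor. 3.85] [cite: BierstoneGrigorievMilmanWlodarczyk2011, Lemma 3.9.4 (3)] -/
theorem allRegular_pushforward : ∀ {S X : Scheme.{u}} [IsLocallyNoetherian X] [IsLocallyNoetherian S]
    (t : CentreSeq S) (j : S ⟶ X) [IsClosedImmersion j], Scheme.IsRegular X →
    (∀ x ∈ j.ker.support, ∃ v : X.presheaf.stalk x,
      stalkIdeal j.ker x = Ideal.span {v} ∧ v ∉ (maximalIdeal (X.presheaf.stalk x)) ^ 2) →
    t.AllRegular →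
    (t.pushforward j).AllRegular ∧ Scheme.IsRegular (t.pushforward j).top ∧
      ∀ x ∈ (t.pushforwardι j).ker.support, ∃ v : (t.pushforward j).top.presheaf.stalk x,
        stalkIdeal (t.pushforwardι j).ker x = Ideal.span {v} ∧ v ∉ (maximalIdeal ((t.pushforward j).top.presheaf.stalk x)) ^ 2
  | _, _, _, _, CentreSeq.nil _, j, _, hX, hH, _ => ⟨trivial, hX, hH⟩
  | _, _, _, _, CentreSeq.cons Z rest, j, _, hX, hH, hreg => by
    obtain ⟨hZ, hrest⟩ := hreg
    haveI : IsLocallyNoetherian (blowup (Z.map j)) := CentreSeq.isLocallyNoetherian_blowup _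
    haveI : IsLocallyNoetherian (blowup Z) := CentreSeq.isLocallyNoetherian_blowup Z
    have hZX : Scheme.IsRegular (Z.map j).subscheme := (isRegular_subscheme_map_iff_of_isClosedImmersion j Z).mpr hZ
    have hπ : IsBlowup (blowup.π (Z.map j)) (Z.map j) := blowup.isBlowup _
    have hX₁ : Scheme.IsRegular (blowup (Z.map j)) := hπ.isRegular_of_isRegular_subscheme hX hZX
    have hH₁ : ∀ x ∈ (blowup.pushforwardMap Z j).ker.support, ∃ v : (blowup (Z.map j)).presheaf.stalk x,
        stalkIdeal (blowup.pushforwardMap Z j).ker x = Ideal.span {v} ∧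
          v ∉ (maximalIdeal ((blowup (Z.map j)).presheaf.stalk x)) ^ 2 := by
      rw [blowup.ker_pushforwardMap j Z hX hZX hH]
      exact hπ.exists_generator_notMem_sq_controlledTransform hX hZX (ker_le_map Z j) hH
    obtain ⟨hreg₁, htop₁, hH'⟩ := allRegular_pushforward rest (blowup.pushforwardMap Z j) hX₁ hH₁ hrest
    exact ⟨⟨hZX, hreg₁⟩, htop₁, hH'⟩

/-! ## §2 The total-transform rule and legality transport -/

/-- [OURS · L1 W5.2 · (M2b-T) (T-a′)] **TOTAL-TRANSFORM RULE** `(K𝒪_{X_r})|_{S_r} = (K|_S)𝒪_{S_r}`: pulling `K` back along the push-forward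
and restricting to the last embedding is pulling `K|_S` back along the sequence on `S` (`Π ≫ j = j_r ≫ Π^X`, Kollár 3.30.3). [cite: Kollar2007, 3.30.3] -/
theorem comap_pushforward_comp (t : CentreSeq S) (j : S ⟶ X) [IsClosedImmersion j] (K : X.IdealSheafData) :
    (K.comap (t.pushforward j).comp).comap (t.pushforwardι j) = (K.comap j).comap t.comp := by
  rw [← Scheme.IdealSheafData.comap_comp, ← Scheme.IdealSheafData.comap_comp, CentreSeq.pushforward_comp_ι]

/-- [OURS · L1 W5.2 · (M2b-T) (T-a′)] **LEGALITY TRANSPORT**: centres over `j⁻¹ T` push forward to centres over `T`.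
[cite: Kollar2007, 3.30.3] -/
theorem centresOver_pushforward : ∀ {S X : Scheme.{u}} (t : CentreSeq S) (j : S ⟶ X) [IsClosedImmersion j] (T : Set X),
    t.CentresOver (j ⁻¹' T) → (t.pushforward j).CentresOver T
  | _, _, CentreSeq.nil _, _, _, _, _ => trivial
  | _, _, CentreSeq.cons Z rest, j, _, T, h => by
    obtain ⟨hZ, hrest⟩ := h
    refine ⟨?_, centresOver_pushforward rest (blowup.pushforwardMap Z j) _ (CentreSeq.CentresOver.mono rest ?_ hrest)⟩
    · rw [coe_support_map_of_isClosedImmersion]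
      rintro _ ⟨s, hs, rfl⟩
      exact hZ hs
    · intro y hy
      show (blowup.pushforwardMap Z j ≫ blowup.π (Z.map j)) y ∈ T
      rw [blowup.pushforwardMap_π]
      exact hy

/-- [OURS · L1 W5.2 · (M2b-T) (T-a′)] In particular: centres over the cosupport of `K|_S` push forward to centres over the cosupport of `K`
(PhaseCOne-legality of the transported sequence). [cite: Kollar2007, 3.30.3] -/
theorem centresOver_pushforward_support (t : CentreSeq S) (j : S ⟶ X) [IsClosedImmersion j] (K : X.IdealSheafData)
    (h : t.CentresOver (((K.comap j).support : Set S))) : (t.pushforward j).CentresOver (K.support : Set X) := by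
  refine centresOver_pushforward t j _ (CentreSeq.CentresOver.mono t (fun s hs => ?_) h)
  rw [Scheme.IdealSheafData.support_comap] at hs
  exact hs

/-- [OURS · L1 W5.2 · (M2b-T) (T-a′)] **THE VEHICLE, assembled**: regular centres over `cosupp (K|_S)` on the carrier push forward to a
sequence on `X` with regular centres over `cosupp K`, regular top, a regular-hypersurface last embedding `j_r`, and
`(K𝒪_{X_r})|_{S_r} = (K|_S)𝒪_{S_r}`. [cite: Kollar2007, 3.30.3, Cor. 3.85] -/
theorem vehicle [IsLocallyNoetherian X] [IsLocallyNoetherian S] (t : CentreSeq S) (j : S ⟶ X) [IsClosedImmersion j]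
    (hX : Scheme.IsRegular X)
    (hH : ∀ x ∈ j.ker.support, ∃ v : X.presheaf.stalk x,
      stalkIdeal j.ker x = Ideal.span {v} ∧ v ∉ (maximalIdeal (X.presheaf.stalk x)) ^ 2)
    (hreg : t.AllRegular) (K : X.IdealSheafData) (hover : t.CentresOver (((K.comap j).support : Set S))) :
    (t.pushforward j).AllRegular ∧ (t.pushforward j).CentresOver (K.support : Set X) ∧ Scheme.IsRegular (t.pushforward j).top ∧
      (∀ x ∈ (t.pushforwardι j).ker.support, ∃ v : (t.pushforward j).top.presheaf.stalk x,
        stalkIdeal (t.pushforwardι j).ker x = Ideal.span {v} ∧ v ∉ (maximalIdeal ((t.pushforward j).top.presheaf.stalk x)) ^ 2) ∧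
      (K.comap (t.pushforward j).comp).comap (t.pushforwardι j) = (K.comap j).comap t.comp := by
  obtain ⟨h1, h2, h3⟩ := allRegular_pushforward t j hX hH hreg
  exact ⟨h1, centresOver_pushforward_support t j K hover, h2, h3, comap_pushforward_comp t j K⟩

end ContactPushforward

end Summit.ResolutionOfSingularities.ResolutionOfSingularities.Theorems

end
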